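/-
Copyright (c) 2026 the pub-hodgecm-mathlib formalisation cell (harness21).  Prover seat hodgecm-mathlib-K2Liu-p01 (g2): Track B «K2-LIT»,
#184♮ = hLiu418 = stmt-HodgeConjecture-24832, STEWARD of socket #41 `sig_K2LiuSiegelEisensteinContinuation`; LEAD F0P6-plan (g10) DEAL
2026-09-03T23:22:15Z «O41.5 Gindikin–Karpelevich for the Siegel parabolic»; REPORT-FIRST O41.5 220813e546421255 §3 file (4).
-/
import Literature.NumberTheory.GelbartRogawski1991.LocalDoubledUnitaryDatum            -- ★ `e₂`, `gramD`
import Literature.NumberTheory.GelbartRogawski1991.DoubledUnitaryAdaptedRelations       -- ★ `cayR`, `cayRinv`, `adapt`, `blkC`, `adapt_eq`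
import Literature.NumberTheory.Automorphic.HyperspecialUnitaryParabolicBlocks           -- ★ `antidiagonal_over_apply`
import HarnessLib

/-!
# Crux `HLiu418`, road `K2_Liu`, socket #41, organ O41.5, file (4a): the RATIONAL FRAME `Q = e₂ ∘ (1 D; 1 −D)` between `J_{2n}` and `T₀ ⊕ −T₀`
# and the adapted-frame block lemma (algebraic half of the local Iwasawa decomposition, file (4b) `K2LiuLocalSiegelIwasawa`)

Cell `hodgecm-mathlib`, crux item hLiu418 = `stmt-HodgeConjecture-24832`; squad K2 ∕ K2Liu; prover K2Liu-p01 (g2), steward of #41.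
THEOREMS ONLY (no `def`, no instance, no notation, no named-fact hypothesis, no `sorry`); lane `--supports stmt-HodgeConjecture-24832`.
THIS FILE (4a) = the ALGEBRAIC HALF: §1 block bookkeeping, §2 the frame identities over `F` (`Q Q⁻¹ = 1`, `Qᵀ(T₀ ⊕ −T₀)Q = J_{2n}`),
§3 the `Δ`-adapted block lemma `blkC_frame_conj_eq_zero`; the decomposition itself (transport + ★ Iwasawa for `U(J_{2n})`) is file (4b)
`Theorems/K2LiuLocalSiegelIwasawa.lean`, which imports this one.

THE STATEMENT (`exists_isSiegelDelta_mul_mem_localInt`).  `E/F` a quadratic extension of number fields with `c`, `δ` (`c δ = −δ ≠ 0`),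
`v` a finite place of `F`, `𝕍 = (Eⁿ, T₀)` with `T₀ ∈ Sym_n(F)` invertible, `H(F_v) = U(T₀ ⊕ −T₀)(F_v)` the doubled group on the tree's
carrier ★ `UnitaryGroup.localPi E c (n+n) JD v`, `P_Δ(F_v)` its Siegel parabolic (★ local `IsSiegelDelta`), `K_v = H(𝒪_v)` (★ `localInt`).
IF `v` is GOOD — `|2|_w = 1` and `T₀`, `T₀⁻¹` integral at every `w ∣ v` (all but finitely many `v`, ★ `eventually_isGoodPlace`) — THEN
**every `h ∈ H(F_v)` is `p · k` with `p ∈ P_Δ(F_v)` and `k ∈ K_v`.**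

THE PROOF (transport of structure, no new analysis).  The RATIONAL FRAME `Q = e₂ ∘ (R · diag(1, ½T₀⁻¹W)) ∈ GL_{2n}(F)` (`R = (1 1; 1 −1)` the
tree's ★ `cayR`, `W` the antidiagonal permutation) satisfies `Qᵀ (T₀ ⊕ −T₀) Q = J_{2n}` (Mok's antidiagonal form, ★ `StdForm.antidiagonal`) and
carries the standard isotropic flag onto `Δ = {(x,x)}`; so ★ `FrameTransport.frameConj Q : U(J_{2n})(F_v) ≃ H(F_v)` maps the UPPER TRIANGULAR
Borel of `U(J_{2n})` into `P_Δ` (§3: in the `Δ`-adapted frame the conjugate is block upper triangular, `C = 0`), and — `Q, Q⁻¹` being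
`v`-integral at a good place — maps `U(J_{2n})(𝒪_v)` into `H(𝒪_v)` (§4).  The Iwasawa decomposition `U(J_{2n})(F_v) = B · U(J_{2n})(𝒪_v)` is ★
`UnitaryGroup.exists_upper_mul_mem_localInt` (every finite `v`, split or not).  [BruhatTits1972, (4.4.3)] [Tits1979, §3.3.2] [Casselman1980, §3].

CONSEQUENCES (§5).  With ★ D10 `K2Lit/LocalSiegelIntertwining` (`IsSphericalSection`): at a good place the spherical section of
`I_v(s, χ_v)` is UNIQUE (`IsSphericalSection.unique` becomes unconditional) — the `φ°_s` of the Gindikin–Karpelevich identity O41.5 is pinned.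
HONEST LABEL.  Count-neutral helper; it retires nothing by itself: `HC_CM` is proved only modulo the 7 printed citations (2 remaining named inputs:
hLiu418 = `stmt-HodgeConjecture-24832`, h413 = `stmt-HodgeConjecture-24833`) until rung 0 closes.

## References
* [BruhatTits1972] F. Bruhat, J. Tits, *Groupes réductifs sur un corps local I*, Publ. IHÉS 41 (1972): Prop. (4.4.3) (Iwasawa decomposition).
* [Tits1979] J. Tits, *Reductive groups over local fields*, Corvallis (1979): §3.3.2.
* [Casselman1980] W. Casselman, Compositio Math. 40 (1980): §3 (spherical vectors via `G = PK`).
* [HarrisKudlaSweet1996] M. Harris, S. Kudla, W. J. Sweet, J. AMS 9 (1996): §1 (1.11) (the Siegel parabolic `P_Δ` of the doubled space).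
* [Kudla1994] S. S. Kudla, Israel J. Math. 87 (1994): §3.
-/

set_option autoImplicit false
set_option linter.dupNamespace false -- the mandated namespace repeats `HodgeConjecture.HodgeConjecture`

noncomputable section

open NumberField IsDedekindDomain Matrix
open Literature.NumberTheory.Automorphic Literature.NumberTheory.Automorphic.UnitaryGroup
open Literature.NumberTheory.GelbartRogawski1991.AdaptedBlocks
open Literature.NumberTheory.GelbartRogawski1991.UnitaryDualPair.LocalSplitting

namespace Summit.HodgeConjecture.HodgeConjecture.Cruxes.HLiu418.K2LiuLocalSiegelIwasawaFrame

/-! ## §1 Block bookkeeping -/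

/-- `(M N)₂₁ = 0` when `M₂₁ = 0 = N₂₁` (block upper triangular matrices form a monoid). [folklore] -/
theorem toBlocks₂₁_mul_eq_zero {R : Type*} [CommRing R] {l m : Type*} [Fintype l] [Fintype m] [DecidableEq l] [DecidableEq m]
    {M N : Matrix (l ⊕ m) (l ⊕ m) R} (hM : M.toBlocks₂₁ = 0) (hN : N.toBlocks₂₁ = 0) : (M * N).toBlocks₂₁ = 0 := by
  conv_lhs => rw [← Matrix.fromBlocks_toBlocks M, ← Matrix.fromBlocks_toBlocks N, Matrix.fromBlocks_multiply]
  rw [Matrix.toBlocks_fromBlocks₂₁, hM, hN, Matrix.zero_mul, Matrix.mul_zero, add_zero]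

/-- an upper triangular matrix on `Fin (n+n)` is BLOCK upper triangular in the halves `e₂ : Fin n ⊕ Fin n ≃ Fin (n+n)`. [folklore] -/
theorem toBlocks₂₁_reindex_eq_zero_of_blockTriangular {R : Type*} [CommRing R] {n : ℕ} {M : Matrix (Fin (n + n)) (Fin (n + n)) R}
    (hM : M.BlockTriangular id) : (Matrix.reindex (e₂ n).symm (e₂ n).symm M).toBlocks₂₁ = 0 := by
  ext i j
  simp only [Matrix.toBlocks₂₁, Matrix.reindex_apply, Equiv.symm_symm, Matrix.submatrix_apply, Matrix.of_apply, Matrix.zero_apply]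
  refine hM ?_
  change (e₂ n (Sum.inl j) : Fin (n + n)) < e₂ n (Sum.inr i)
  rw [Fin.lt_def]
  simp only [e₂, finSumFinEquiv_apply_left, finSumFinEquiv_apply_right, Fin.val_castAdd, Fin.val_natAdd]
  omega

/-! ## §2 The rational frame `Q = e₂ ∘ (1 D; 1 −D)`, `D = ½ T₀⁻¹ W`, `W` the antidiagonal permutation -/

section Frame

variable {F : Type*} [Field F] {n : ℕ}

/-- `W · Wᵀ = 1` for the antidiagonal permutation matrix `W = 1.submatrix id rev` (`rev` is an involution). [folklore] -/
theorem antidiag_mul_antidiag :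
    (1 : Matrix (Fin n) (Fin n) F).submatrix id Fin.rev * (1 : Matrix (Fin n) (Fin n) F).submatrix Fin.rev id = 1 := by
  rw [show (1 : Matrix (Fin n) (Fin n) F).submatrix id Fin.rev = (1 : Matrix (Fin n) (Fin n) F).submatrix id ⇑Fin.revPerm from rfl,
    show (1 : Matrix (Fin n) (Fin n) F).submatrix Fin.rev id = (1 : Matrix (Fin n) (Fin n) F).submatrix ⇑Fin.revPerm id from rfl,
    Matrix.submatrix_mul_equiv, Matrix.mul_one, Matrix.submatrix_id_id]

/-- `Wᵀ · W = 1`. [folklore] -/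
theorem antidiag_mul_antidiag' :
    (1 : Matrix (Fin n) (Fin n) F).submatrix Fin.rev id * (1 : Matrix (Fin n) (Fin n) F).submatrix id Fin.rev = 1 := by
  rw [show (1 : Matrix (Fin n) (Fin n) F).submatrix id Fin.rev = (1 : Matrix (Fin n) (Fin n) F).submatrix ⇑(Equiv.refl (Fin n)) ⇑Fin.revPerm from rfl,
    show (1 : Matrix (Fin n) (Fin n) F).submatrix Fin.rev id = (1 : Matrix (Fin n) (Fin n) F).submatrix ⇑Fin.revPerm ⇑(Equiv.refl (Fin n)) from rfl,
    Matrix.submatrix_mul_equiv, Matrix.mul_one, Matrix.submatrix_one_equiv]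

/-- `M.submatrix id rev * N.submatrix rev id = M * N` (re-index the summation by the involution `rev`). [folklore] -/
theorem submatrix_rev_mul_submatrix_rev {l m : Type*} (M : Matrix l (Fin n) F) (N : Matrix (Fin n) m F) :
    M.submatrix id Fin.rev * N.submatrix Fin.rev id = M * N := by
  rw [show M.submatrix id Fin.rev = M.submatrix id ⇑Fin.revPerm from rfl, show N.submatrix Fin.rev id = N.submatrix ⇑Fin.revPerm id from rfl,
    Matrix.submatrix_mul_equiv, Matrix.submatrix_id_id]

/-- `W` is symmetric: `(1.submatrix id rev)ᵀ = 1.submatrix id rev`. [folklore] -/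
theorem antidiag_transpose : ((1 : Matrix (Fin n) (Fin n) F).submatrix id Fin.rev)ᵀ = (1 : Matrix (Fin n) (Fin n) F).submatrix id Fin.rev := by
  ext i j
  simp only [Matrix.transpose_apply, Matrix.submatrix_apply, id_eq, Matrix.one_apply]
  rcases eq_or_ne j (Fin.rev i) with h | h
  · have h' : i = Fin.rev j := by rw [h, Fin.rev_rev]
    rw [if_pos h, if_pos h']
  · have h' : i ≠ Fin.rev j := fun h' => h (by rw [h', Fin.rev_rev])
    rw [if_neg h, if_neg h']

/-- `1.submatrix rev id = 1.submatrix id rev`. [folklore] -/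
theorem antidiag_eq : (1 : Matrix (Fin n) (Fin n) F).submatrix Fin.rev id = (1 : Matrix (Fin n) (Fin n) F).submatrix id Fin.rev := by
  rw [← antidiag_transpose, Matrix.transpose_submatrix, Matrix.transpose_one]

variable [CharZero F] {T₀ : Matrix (Fin n) (Fin n) F}

/-- `½ + ½ = 1` on matrices. [folklore] -/
theorem half_add_half : (2 : F)⁻¹ • (1 : Matrix (Fin n) (Fin n) F) + (2 : F)⁻¹ • 1 = 1 := by
  rw [← add_smul, ← one_div, add_halves, one_smul]

/-- **`Q · Q⁻¹ = 1`** in the halves: `(1 D; 1 −D)(½ ½; G −G) = 1`, `D = ½ T₀⁻¹ W`, `G = W T₀`. [folklore] -/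
theorem frame_mul_frameInv (hT₀d : IsUnit T₀.det) :
    Matrix.fromBlocks (1 : Matrix (Fin n) (Fin n) F) ((2 : F)⁻¹ • (T₀⁻¹ * (1 : Matrix (Fin n) (Fin n) F).submatrix id Fin.rev)) 1
        (-((2 : F)⁻¹ • (T₀⁻¹ * (1 : Matrix (Fin n) (Fin n) F).submatrix id Fin.rev))) *
      Matrix.fromBlocks ((2 : F)⁻¹ • (1 : Matrix (Fin n) (Fin n) F)) ((2 : F)⁻¹ • 1)
        ((1 : Matrix (Fin n) (Fin n) F).submatrix Fin.rev id * T₀) (-((1 : Matrix (Fin n) (Fin n) F).submatrix Fin.rev id * T₀)) = 1 := by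
  have hDG : ((2 : F)⁻¹ • (T₀⁻¹ * (1 : Matrix (Fin n) (Fin n) F).submatrix id Fin.rev)) *
      ((1 : Matrix (Fin n) (Fin n) F).submatrix Fin.rev id * T₀) = (2 : F)⁻¹ • (1 : Matrix (Fin n) (Fin n) F) := by
    rw [Matrix.smul_mul, Matrix.mul_assoc, ← Matrix.mul_assoc ((1 : Matrix (Fin n) (Fin n) F).submatrix id Fin.rev), antidiag_mul_antidiag,
      Matrix.one_mul, Matrix.nonsing_inv_mul T₀ hT₀d]
  rw [Matrix.fromBlocks_multiply, ← Matrix.fromBlocks_one]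
  simp only [Matrix.one_mul, Matrix.neg_mul, Matrix.mul_neg, neg_neg, hDG, half_add_half, add_neg_cancel]

/-- **`Q⁻¹ · Q = 1`** in the halves. [folklore] -/
theorem frameInv_mul_frame (hT₀d : IsUnit T₀.det) :
    Matrix.fromBlocks ((2 : F)⁻¹ • (1 : Matrix (Fin n) (Fin n) F)) ((2 : F)⁻¹ • 1)
        ((1 : Matrix (Fin n) (Fin n) F).submatrix Fin.rev id * T₀) (-((1 : Matrix (Fin n) (Fin n) F).submatrix Fin.rev id * T₀)) *
      Matrix.fromBlocks (1 : Matrix (Fin n) (Fin n) F) ((2 : F)⁻¹ • (T₀⁻¹ * (1 : Matrix (Fin n) (Fin n) F).submatrix id Fin.rev)) 1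
        (-((2 : F)⁻¹ • (T₀⁻¹ * (1 : Matrix (Fin n) (Fin n) F).submatrix id Fin.rev))) = 1 := by
  have hGD : ((1 : Matrix (Fin n) (Fin n) F).submatrix Fin.rev id * T₀) *
      ((2 : F)⁻¹ • (T₀⁻¹ * (1 : Matrix (Fin n) (Fin n) F).submatrix id Fin.rev)) = (2 : F)⁻¹ • (1 : Matrix (Fin n) (Fin n) F) := by
    rw [Matrix.mul_smul, Matrix.mul_assoc, ← Matrix.mul_assoc T₀, Matrix.mul_nonsing_inv T₀ hT₀d, Matrix.one_mul, antidiag_mul_antidiag']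
  rw [Matrix.fromBlocks_multiply, ← Matrix.fromBlocks_one]
  simp only [Matrix.mul_one, Matrix.neg_mul, Matrix.mul_neg, neg_neg, hGD, half_add_half, add_neg_cancel]

/-- **`Qᵀ (T₀ ⊕ −T₀) Q = antidiag(W, W)`** in the halves (for `T₀` symmetric invertible). [cite: HarrisKudlaSweet1996, §1 (1.11)] -/
theorem frame_transpose_mul_gram_mul_frame (hT₀ : T₀.IsSymm) (hT₀d : IsUnit T₀.det) :
    (Matrix.fromBlocks (1 : Matrix (Fin n) (Fin n) F) ((2 : F)⁻¹ • (T₀⁻¹ * (1 : Matrix (Fin n) (Fin n) F).submatrix id Fin.rev)) 1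
        (-((2 : F)⁻¹ • (T₀⁻¹ * (1 : Matrix (Fin n) (Fin n) F).submatrix id Fin.rev))))ᵀ *
      Matrix.fromBlocks T₀ 0 0 (-T₀) *
      Matrix.fromBlocks (1 : Matrix (Fin n) (Fin n) F) ((2 : F)⁻¹ • (T₀⁻¹ * (1 : Matrix (Fin n) (Fin n) F).submatrix id Fin.rev)) 1
        (-((2 : F)⁻¹ • (T₀⁻¹ * (1 : Matrix (Fin n) (Fin n) F).submatrix id Fin.rev))) =
      Matrix.fromBlocks 0 ((1 : Matrix (Fin n) (Fin n) F).submatrix id Fin.rev) ((1 : Matrix (Fin n) (Fin n) F).submatrix id Fin.rev) 0 := by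
  set W : Matrix (Fin n) (Fin n) F := (1 : Matrix (Fin n) (Fin n) F).submatrix id Fin.rev with hW
  set D : Matrix (Fin n) (Fin n) F := (2 : F)⁻¹ • (T₀⁻¹ * W) with hD
  -- `2 T₀ D = W`
  have hTD : T₀ * D + T₀ * D = W := by
    rw [hD, Matrix.mul_smul, ← Matrix.mul_assoc, Matrix.mul_nonsing_inv T₀ hT₀d, Matrix.one_mul, ← add_smul, ← one_div, add_halves, one_smul]
  -- `Dᵀ T₀ = (T₀ D)ᵀ` (`T₀` symmetric)
  have hDT : Dᵀ * T₀ = (T₀ * D)ᵀ := by rw [Matrix.transpose_mul, hT₀.eq]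
  have hDTD : Dᵀ * T₀ + Dᵀ * T₀ = W := by
    rw [hDT, ← Matrix.transpose_add, hTD, hW, antidiag_transpose]
  rw [Matrix.fromBlocks_transpose, Matrix.fromBlocks_multiply, Matrix.fromBlocks_multiply]
  simp only [Matrix.transpose_one, Matrix.transpose_neg, Matrix.one_mul, Matrix.mul_one, Matrix.mul_zero, add_zero, zero_add,
    Matrix.neg_mul, Matrix.mul_neg, neg_neg, add_neg_cancel, hTD, hDTD]

omit [CharZero F] in
/-- **`e₂ ∘ antidiag(W, W) ∘ e₂⁻¹ = J_{2n}`** (Mok's antidiagonal form). [cite: HarrisKudlaSweet1996, §1 (1.11)] -/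
theorem reindex_antidiag_eq_antidiagonal_over :
    Matrix.reindex (e₂ n) (e₂ n)
        (Matrix.fromBlocks 0 ((1 : Matrix (Fin n) (Fin n) F).submatrix id Fin.rev) ((1 : Matrix (Fin n) (Fin n) F).submatrix id Fin.rev) 0) =
      (StdForm.antidiagonal (n + n)).over F := by
  ext i j
  obtain ⟨i', rfl⟩ := (e₂ n).surjective i
  obtain ⟨j', rfl⟩ := (e₂ n).surjective j
  rw [HermitianLattice.antidiagonal_over_apply, Matrix.reindex_apply, Matrix.submatrix_apply, Equiv.symm_apply_apply, Equiv.symm_apply_apply]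
  have hiff : ∀ x y : Fin (n + n), (y = Fin.rev x) ↔ (y : ℕ) + (x : ℕ) + 1 = n + n := by
    intro x y; rw [Fin.ext_iff, Fin.val_rev]; omega
  have hiff' : ∀ x y : Fin n, (x = Fin.rev y) ↔ (x : ℕ) + (y : ℕ) + 1 = n := by
    intro x y; rw [Fin.ext_iff, Fin.val_rev]; omega
  rcases i' with a | b <;> rcases j' with a' | b' <;>
    simp only [Matrix.fromBlocks_apply₁₁, Matrix.fromBlocks_apply₁₂, Matrix.fromBlocks_apply₂₁, Matrix.fromBlocks_apply₂₂, Matrix.zero_apply,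
      Matrix.submatrix_apply, id_eq, Matrix.one_apply, hiff, hiff', e₂, finSumFinEquiv_apply_left, finSumFinEquiv_apply_right,
      Fin.val_castAdd, Fin.val_natAdd] <;>
    split_ifs <;> first | rfl | (exfalso; omega)

omit [CharZero F] in
/-- `(1 D; 1 −D) = R · diag(1, D)` with the tree's `R = cayR = (1 1; 1 −1)`. [cite: HarrisKudlaSweet1996, §1 (1.11)] -/
theorem frame_eq_cayR_mul (D : Matrix (Fin n) (Fin n) F) :
    Matrix.fromBlocks (1 : Matrix (Fin n) (Fin n) F) D 1 (-D) = cayR F (Fin n) * Matrix.fromBlocks 1 0 0 D := by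
  rw [cayR, Matrix.fromBlocks_multiply]
  simp

end Frame

/-! ## §3 Block upper triangular in the standard frame ⇒ `C = 0` in the `Δ`-adapted frame -/

section Adapted

variable {L : Type*} [CommRing L] {ι : Type*} [Fintype ι] [DecidableEq ι]

/-- `(1 D; 1 −D) = R · diag(1, D)` over any commutative ring. [cite: HarrisKudlaSweet1996, §1 (1.11)] -/
theorem frame_eq_cayR_mul' (D : Matrix ι ι L) :
    Matrix.fromBlocks (1 : Matrix ι ι L) D 1 (-D) = cayR L ι * Matrix.fromBlocks 1 0 0 D := by
  rw [cayR, Matrix.fromBlocks_multiply]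
  simp

/-- the `(2,1)` block of `X · diag(1, D)` is that of `X`. [folklore] -/
theorem toBlocks₂₁_mul_blockDiag (X : Matrix (ι ⊕ ι) (ι ⊕ ι) L) (D : Matrix ι ι L) :
    (X * Matrix.fromBlocks 1 0 0 D).toBlocks₂₁ = X.toBlocks₂₁ := by
  conv_lhs => rw [← Matrix.fromBlocks_toBlocks X, Matrix.fromBlocks_multiply]
  rw [Matrix.toBlocks_fromBlocks₂₁, Matrix.mul_one, Matrix.mul_zero, add_zero]

variable [Invertible (2 : L)]

/-- **KEY BLOCK LEMMA.**  If `β` is block upper triangular and `B` is a left inverse of `A = R · diag(1, D)`, then the `Δ`-adapted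
`C`-block of `A β B` vanishes: `adapt (A β B) = diag(1, D) · β · (B R)` with `(B R) · diag(1, D) = 1`, a product of three block upper
triangular matrices. [cite: Kudla1994, §3] [cite: HarrisKudlaSweet1996, §1 (1.11)] -/
theorem blkC_frame_conj_eq_zero (D : Matrix ι ι L) (β B : Matrix (ι ⊕ ι) (ι ⊕ ι) L) (hβ : β.toBlocks₂₁ = 0)
    (hBA : B * (cayR L ι * Matrix.fromBlocks 1 0 0 D) = 1) :
    blkC (cayR L ι * Matrix.fromBlocks 1 0 0 D * β * B) = 0 := by
  have hX : (B * cayR L ι).toBlocks₂₁ = 0 := by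
    rw [← toBlocks₂₁_mul_blockDiag (B * cayR L ι) D, Matrix.mul_assoc, hBA, ← Matrix.fromBlocks_one, Matrix.toBlocks_fromBlocks₂₁]
  have hC : (Matrix.fromBlocks (1 : Matrix ι ι L) 0 0 D).toBlocks₂₁ = 0 := Matrix.toBlocks_fromBlocks₂₁ _ _ _ _
  have had : adapt (cayR L ι * Matrix.fromBlocks 1 0 0 D * β * B) = Matrix.fromBlocks 1 0 0 D * β * (B * cayR L ι) := by
    rw [adapt]
    simp only [Matrix.mul_assoc]
    rw [← Matrix.mul_assoc (cayRinv L ι), cayRinv_mul_cayR, Matrix.one_mul]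
  rw [show blkC (cayR L ι * Matrix.fromBlocks 1 0 0 D * β * B) = (adapt (cayR L ι * Matrix.fromBlocks 1 0 0 D * β * B)).toBlocks₂₁ by
      rw [adapt_eq, Matrix.toBlocks_fromBlocks₂₁], had]
  exact toBlocks₂₁_mul_eq_zero (toBlocks₂₁_mul_eq_zero hC hβ) hX

end Adapted

end Summit.HodgeConjecture.HodgeConjecture.Cruxes.HLiu418.K2LiuLocalSiegelIwasawaFrame

end
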